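import Literature.NumberTheory.Automorphic.QuaternionEuclideanEmbedding
import Literature.NumberTheory.Automorphic.QuaternionSubidealCount
import Literature.NumberTheory.Automorphic.QuaternionLocalUnitDensity
import Literature.NumberTheory.Automorphic.RamifiedPrimeIdeal
import HarnessLib

/-!
# `covol(I⁻¹) · covol(I) = covol(O)²` for an invertible right ideal `I` and its transporter
# `I⁻¹ = {x | x I ⊆ O}` (local principality and the indices of one-sided translates)

Topic `NumberTheory/Automorphic`; theorems only (no definition, no named fact, no instance).
For a `ℤ`-order `O` of a totally definite quaternion algebra `B` over `ℚ`, an invertible right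
`O`-ideal `I` and its left transporter `I⁻¹ = {x ∈ B | x I ⊆ O}` (`transporterLeft I O`), the
covolumes of the Euclidean model (`QuaternionEuclideanEmbedding.lean`) satisfy

  `covol ψ I⁻¹ · covol ψ I = (covol ψ O)²`   (`covol_transporterLeft_mul_covol`).

This is the lattice-theoretic identity "`n(I⁻¹) n(I) = 1`" (Vignéras I §4, norme réduite d'un
idéal, `N(I) = n(I)²`; III §5: `I` est localement principal) in the form used by the
lattice-point count of Eichler's mass formula (`brandtModule_massFormula`): with `d I ⊆ O`,
`d I⁻¹ ⊆ O`, one has `covol ψ (d M) = [O : d M] covol ψ O = d⁴ covol ψ M`, and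
`[O : d I⁻¹] [O : d I] = d⁸` is checked prime by prime — `I₍ₚ₎ = β O₍ₚ₎` (Kaplansky,
`IsInvertibleRightIdeal.exists_localAt_eq_units_smul`), so `(d I)₍ₚ₎ = (dβ) O₍ₚ₎` has index
`p^{2 v_p(nrd(dβ))}` and `(d I⁻¹)₍ₚ₎ = O₍ₚ₎ (dβ⁻¹)` has index `p^{2 v_p(nrd(dβ⁻¹))}`
(`relIndex_op_units_smul_localAt`, the right-handed version of `[O₍ₚ₎ : z O₍ₚ₎] = p^{2v_p(nrd z)}`
obtained through the standard involution).

## References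

* M.-F. Vignéras, *Arithmétique des algèbres de quaternions*, LNM 800 (1980), Ch. I §4
  (Lemme 4.1, norme réduite), Ch. III §5 B [VignerasLNM800].
* J. Voight, *Quaternion Algebras*, GTM 288 (2021), 16.3–16.6, Main Thm. 16.6.1.
-/

noncomputable section

open scoped Pointwise
open Module

universe u

namespace Literature.NumberTheory.Automorphic

variable {B : Type u} [Ring B] [Algebra ℚ B] [IsQuaternionAlgebra ℚ B]

/-! ### Right translates through the standard involution -/

section RightTranslate

/-- The conjugate `z̄` of a unit `z` of `B` is a unit (inverse `\overline{z⁻¹}`). [folklore] -/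
theorem exists_units_val_eq_standardInvolution (z : Bˣ) :
    ∃ zc : Bˣ, (zc : B) = standardInvolution ℚ B z ∧ ((zc⁻¹ : Bˣ) : B) = standardInvolution ℚ B ((z⁻¹ : Bˣ) : B) := by
  refine ⟨⟨standardInvolution ℚ B z, standardInvolution ℚ B ((z⁻¹ : Bˣ) : B), ?_, ?_⟩, rfl, rfl⟩
  · rw [← standardInvolution_mul_rev ℚ, Units.inv_mul, standardInvolution_one]
  · rw [← standardInvolution_mul_rev ℚ, Units.mul_inv, standardInvolution_one]

omit [Algebra ℚ B] [IsQuaternionAlgebra ℚ B] in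
/-- Membership in a right translate `O (op u)`: `x ∈ op u • L ↔ x u⁻¹ ∈ L`. Duplicate (explicit
arguments) of `mem_op_units_smul_submodule_iff` (`BrandtModule`, in the import closure); deprecated
restatement (dedup-01129, 2026-08-16). [folklore] -/
@[deprecated mem_op_units_smul_submodule_iff (since := "2026-08-16")]
theorem mem_op_units_smul_iff (u : Bˣ) (L : Submodule ℤ B) (x : B) :
    x ∈ MulOpposite.op (u : B) • L ↔ x * ((u⁻¹ : Bˣ) : B) ∈ L :=
  mem_op_units_smul_submodule_iff

variable {p : ℕ} [hp : Fact p.Prime]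

/-- **`[O₍ₚ₎ : O₍ₚ₎ z] = p^{2 v_p(nrd z)}` for `z ∈ O₍ₚ₎`** — the right-handed version of
`exists_relIndex_units_smul_localAt_eq_pow`, obtained by applying the standard involution (an
additive bijection with `\overline{O₍ₚ₎ z} = z̄ O₍ₚ₎` and `nrd(z̄) = nrd(z)`). [cite: VignerasLNM800, Ch. I §4 Lemme 4.1 and Ch. I §1 (N = n²)] -/
theorem relIndex_op_units_smul_localAt {O : Submodule ℤ B} (hO : IsZOrder O) (z : Bˣ) (hz : (z : B) ∈ localAt p O)
    {k : ℕ} (hk : padicValRat p (reducedNorm ℚ B (z : B)) = k) :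
    (MulOpposite.op (z : B) • localAt p O).toAddSubgroup.relIndex (localAt p O).toAddSubgroup = p ^ (2 * k) := by
  obtain ⟨zc, hzc, hzcinv⟩ := exists_units_val_eq_standardInvolution z
  -- the involution as an injective additive map
  let σ : B →+ B := AddMonoidHom.mk' (standardInvolution ℚ B) (standardInvolution_add ℚ)
  have hσ : ∀ x, σ x = standardInvolution ℚ B x := fun x => rfl
  have hσinj : Function.Injective σ := fun a b hab => by
    have := congrArg (standardInvolution ℚ B) hab
    rwa [hσ, hσ, standardInvolution_standardInvolution, standardInvolution_standardInvolution] at this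
  have hΛ : (localAt p O).toAddSubgroup.map σ = (localAt p O).toAddSubgroup := by
    ext x
    constructor
    · rintro ⟨y, hy, rfl⟩; exact hO.standardInvolution_mem_localAt hy
    · intro hx
      exact ⟨standardInvolution ℚ B x, hO.standardInvolution_mem_localAt hx, standardInvolution_standardInvolution ℚ x⟩
  have hT : (MulOpposite.op (z : B) • localAt p O).toAddSubgroup.map σ = (zc • localAt p O).toAddSubgroup := by
    ext x
    simp only [AddSubgroup.mem_map, Submodule.mem_toAddSubgroup]
    constructor
    · rintro ⟨y, hy, rfl⟩
      rw [mem_op_units_smul_submodule_iff] at hy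
      rw [mem_units_smul_iff_mul_mem, hzcinv, hσ, ← standardInvolution_mul_rev ℚ]
      exact hO.standardInvolution_mem_localAt hy
    · intro hx
      rw [mem_units_smul_iff_mul_mem, hzcinv] at hx
      refine ⟨standardInvolution ℚ B x, ?_, standardInvolution_standardInvolution ℚ x⟩
      rw [mem_op_units_smul_submodule_iff]
      have := hO.standardInvolution_mem_localAt hx
      rwa [standardInvolution_mul_rev ℚ, standardInvolution_standardInvolution] at this
  have h := AddSubgroup.relIndex_map_map_of_injective (f := σ) (MulOpposite.op (z : B) • localAt p O).toAddSubgroup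
    (localAt p O).toAddSubgroup hσinj
  rw [hΛ, hT] at h
  rw [← h]
  have hzc' : (zc : B) ∈ localAt p O := by rw [hzc]; exact hO.standardInvolution_mem_localAt hz
  obtain ⟨k', hk', hidx⟩ := exists_relIndex_units_smul_localAt_eq_pow hO zc hzc'
  rw [hzc, reducedNorm_standardInvolution ℚ, hk] at hk'
  have : k = k' := by exact_mod_cast hk'
  rw [hidx, this]

end RightTranslate

/-! ### The transporter of a local principal ideal -/

section Transporter

omit [Algebra ℚ B] [IsQuaternionAlgebra ℚ B] in
/-- **`(β X : X)_ℓ = X β⁻¹`** for a multiplicatively closed `X ∋ 1` (an order): the left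
transporter of `β X` into `X` is the right translate `X β⁻¹`. [folklore] -/
theorem transporterLeft_units_smul_eq {X : Submodule ℤ B} (h1 : (1 : B) ∈ X)
    (hmul : ∀ a ∈ X, ∀ b ∈ X, a * b ∈ X) (β : Bˣ) :
    transporterLeft (β • X) X = MulOpposite.op (((β⁻¹ : Bˣ) : B)) • X := by
  ext x
  rw [mem_transporterLeft_iff, mem_op_units_smul_submodule_iff, inv_inv]
  constructor
  · intro h
    have := h (β : B) (by rw [mem_units_smul_iff_mul_mem, Units.inv_mul]; exact h1)
    exact this
  · intro h m hm
    rw [mem_units_smul_iff_mul_mem] at hm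
    have : x * m = (x * (β : B)) * (((β⁻¹ : Bˣ) : B) * m) := by
      rw [mul_assoc, ← mul_assoc (β : B), Units.mul_inv, one_mul]
    rw [this]
    exact hmul _ h _ hm

omit [Algebra ℚ B] [IsQuaternionAlgebra ℚ B] in
/-- The transporter into a translate: `(M : γ N)_ℓ = γ (M : N)_ℓ`. [folklore] -/
theorem transporterLeft_units_smul_right (M N : Submodule ℤ B) (γ : Bˣ) :
    transporterLeft M (γ • N) = γ • transporterLeft M N := by
  ext x
  rw [mem_transporterLeft_iff, mem_units_smul_iff_mul_mem, mem_transporterLeft_iff]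
  constructor
  · intro h m hm
    rw [mul_assoc, ← mem_units_smul_iff_mul_mem]
    exact h m hm
  · intro h m hm
    rw [mem_units_smul_iff_mul_mem, ← mul_assoc]
    exact h m hm

omit [Algebra ℚ B] [IsQuaternionAlgebra ℚ B] in
/-- Integer scaling commutes with right translates. [folklore] -/
theorem intCast_smul_op_units_smul (c : ℤ) (u : Bˣ) (L : Submodule ℤ B) :
    c • (MulOpposite.op (u : B) • L) = MulOpposite.op (u : B) • (c • L) := by
  ext x
  simp only [Submodule.mem_smul_pointwise_iff_exists, MulOpposite.smul_eq_mul_unop, MulOpposite.unop_op]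
  constructor
  · rintro ⟨_, ⟨y, hy, rfl⟩, rfl⟩
    exact ⟨c • y, ⟨y, hy, rfl⟩, by rw [smul_mul_assoc]⟩
  · rintro ⟨_, ⟨y, hy, rfl⟩, rfl⟩
    exact ⟨y * u, ⟨y, hy, rfl⟩, by rw [smul_mul_assoc]⟩

end Transporter

/-! ### `covol(I⁻¹) covol(I) = covol(O)²` -/

section Main

/-- The transporter `I⁻¹ = {x | x I ⊆ O}` of an invertible right ideal is a full lattice.
[cite: VignerasLNM800, Ch. I §4 Lemme 4.1] -/
theorem isFullLattice_transporterLeft (hdiv : ∀ x : B, x ≠ 0 → IsUnit x) {O I : Submodule ℤ B}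
    (hO : IsZOrder O) (hI : IsInvertibleRightIdeal O I) : IsFullLattice B (transporterLeft I O) := by
  haveI : IsAddTorsionFree B := isAddTorsionFree_of_charZero_module ℚ B
  haveI : Nontrivial B := Module.nontrivial_of_finrank_pos (R := ℚ)
    (by rw [IsQuaternionAlgebra.finrank_eq_four (K := ℚ) (D := B)]; norm_num)
  -- a unit of `B` inside `I`
  obtain ⟨b, hbI, hb0⟩ : ∃ b ∈ I, b ≠ 0 := by
    by_contra h
    push Not at h
    obtain ⟨n, hn, hn1⟩ := hI.isFullLattice.2 1
    have := h _ hn1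
    rw [smul_eq_zero] at this
    rcases this with h0 | h0
    · exact hn h0
    · exact one_ne_zero h0
  set β := (hdiv b hb0).unit with hβ
  have hβv : (β : B) = b := IsUnit.unit_spec _
  refine ⟨?_, fun x => ?_⟩
  · -- finitely generated: `I⁻¹ ⊆ O β⁻¹`
    have hle : transporterLeft I O ≤ MulOpposite.op (((β⁻¹ : Bˣ) : B)) • O := by
      intro x hx
      rw [mem_op_units_smul_submodule_iff, inv_inv, hβv]
      exact hx b hbI
    refine Submodule.FG.of_le ?_ hle
    rw [Submodule.pointwise_smul_def]
    exact hO.isFullLattice.1.map _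
  · -- full: some multiple of `x` transports `I` into `O`
    have hfg : (I.map (LinearMap.mulLeft ℤ x)).FG := hI.isFullLattice.1.map _
    obtain ⟨n, hn, hnx⟩ := exists_smul_mem_of_fg hO.isFullLattice hfg
    refine ⟨n, hn, fun m hm => ?_⟩
    rw [smul_mul_assoc]
    exact hnx _ ⟨m, hm, rfl⟩

/-- **`covol ψ I⁻¹ · covol ψ I = (covol ψ O)²`** for an invertible right `O`-ideal `I` of a `ℤ`-order
`O` in a totally definite quaternion algebra over `ℚ`, `I⁻¹ = {x | x I ⊆ O}` (see the module
docstring: local principality and the indices of the one-sided translates `(dβ) O₍ₚ₎`,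
`O₍ₚ₎ (dβ⁻¹)`). [cite: VignerasLNM800, Ch. I §4 Lemme 4.1, Ch. III §5 B] -/
theorem covol_transporterLeft_mul_covol (hdef : IsTotallyDefinite ℚ B)
    (ψ : B →ₗ[ℚ] EuclideanSpace ℝ (Fin 4)) (hψs : Submodule.span ℝ (Set.range ψ) = ⊤)
    (hψn : ∀ x, ‖ψ x‖ ^ 2 = ((reducedNorm ℚ B x : ℚ) : ℝ))
    {O I : Submodule ℤ B} (hO : IsZOrder O) (hI : IsInvertibleRightIdeal O I) :
    covol ψ (transporterLeft I O) * covol ψ I = covol ψ O ^ 2 := by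
  classical
  haveI : IsAddTorsionFree B := isAddTorsionFree_of_charZero_module ℚ B
  have hdiv : ∀ x : B, x ≠ 0 → IsUnit x := fun x hx => isUnit_of_isTotallyDefinite B hdef hx
  have hψi : Function.Injective ψ := injective_euclideanEmbedding ψ hψn hdef
  set J := transporterLeft I O with hJ
  have hJfull : IsFullLattice B J := isFullLattice_transporterLeft hdiv hO hI
  have hIfull : IsFullLattice B I := hI.isFullLattice
  -- a common denominator `d`
  obtain ⟨d, hd0, hdI, hdJ⟩ : ∃ d : ℕ, d ≠ 0 ∧ (d : ℤ) • I ≤ O ∧ (d : ℤ) • J ≤ O := by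
    obtain ⟨n₁, hn₁, h₁⟩ := exists_smul_mem_of_fg hO.isFullLattice hIfull.1
    obtain ⟨n₂, hn₂, h₂⟩ := exists_smul_mem_of_fg hO.isFullLattice hJfull.1
    refine ⟨(n₁ * n₂).natAbs, Int.natAbs_ne_zero.mpr (mul_ne_zero hn₁ hn₂), ?_, ?_⟩
    · intro x hx
      obtain ⟨y, hy, rfl⟩ := (Submodule.mem_smul_pointwise_iff_exists x _ _).mp hx
      rcases Int.natAbs_eq (n₁ * n₂) with h | h
      · rw [show ((n₁ * n₂).natAbs : ℤ) = n₁ * n₂ from h.symm, mul_comm, mul_smul]; exact O.smul_mem _ (h₁ y hy)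
      · rw [show ((n₁ * n₂).natAbs : ℤ) = -(n₁ * n₂) by omega, neg_smul, mul_comm, mul_smul]
        exact O.neg_mem (O.smul_mem _ (h₁ y hy))
    · intro x hx
      obtain ⟨y, hy, rfl⟩ := (Submodule.mem_smul_pointwise_iff_exists x _ _).mp hx
      rcases Int.natAbs_eq (n₁ * n₂) with h | h
      · rw [show ((n₁ * n₂).natAbs : ℤ) = n₁ * n₂ from h.symm, mul_smul]; exact O.smul_mem _ (h₂ y hy)
      · rw [show ((n₁ * n₂).natAbs : ℤ) = -(n₁ * n₂) by omega, neg_smul, mul_smul]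
        exact O.neg_mem (O.smul_mem _ (h₂ y hy))
  -- covolumes of `d I`, `d J`
  have hsmul_le : ∀ L : Submodule ℤ B, (d : ℤ) • L ≤ L := fun L x hx => by
    obtain ⟨y, hy, rfl⟩ := (Submodule.mem_smul_pointwise_iff_exists x _ _).mp hx
    exact L.smul_mem _ hy
  have hdfull : ∀ {L : Submodule ℤ B}, IsFullLattice B L → IsFullLattice B ((d : ℤ) • L) := by
    intro L hL
    refine ⟨by rw [Submodule.pointwise_smul_def]; exact hL.1.map _, fun x => ?_⟩
    obtain ⟨n, hn, hnx⟩ := hL.2 x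
    refine ⟨n * d, mul_ne_zero hn (by exact_mod_cast hd0), ?_⟩
    rw [mul_comm, mul_smul]
    exact Submodule.smul_mem_pointwise_smul _ _ _ hnx
  have hcovI : (d : ℝ) ^ 4 * covol ψ I = (((d : ℤ) • I).toAddSubgroup.relIndex O.toAddSubgroup : ℝ) * covol ψ O := by
    have h1 := covol_eq_relIndex_mul ψ hψs hψi hIfull (hdfull hIfull) (hsmul_le I)
    have h2 := covol_eq_relIndex_mul ψ hψs hψi hO.isFullLattice (hdfull hIfull) hdI
    rw [relIndex_natCast_smul_eq_pow_four hIfull hd0] at h1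
    push_cast at h1
    rw [← h1, h2]
  have hcovJ : (d : ℝ) ^ 4 * covol ψ J = (((d : ℤ) • J).toAddSubgroup.relIndex O.toAddSubgroup : ℝ) * covol ψ O := by
    have h1 := covol_eq_relIndex_mul ψ hψs hψi hJfull (hdfull hJfull) (hsmul_le J)
    have h2 := covol_eq_relIndex_mul ψ hψs hψi hO.isFullLattice (hdfull hJfull) hdJ
    rw [relIndex_natCast_smul_eq_pow_four hJfull hd0] at h1
    push_cast at h1
    rw [← h1, h2]
  -- the index identity `[O : d J] [O : d I] = d⁸`
  set x : ℕ := ((d : ℤ) • J).toAddSubgroup.relIndex O.toAddSubgroup with hx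
  set y : ℕ := ((d : ℤ) • I).toAddSubgroup.relIndex O.toAddSubgroup with hy
  have hcovO := covol_pos ψ hψs hO.isFullLattice (L := O)
  have hx0 : x ≠ 0 := by
    intro h0
    have := covol_pos ψ hψs hJfull (L := J)
    rw [h0, Nat.cast_zero, zero_mul] at hcovJ
    have : (0 : ℝ) < (d : ℝ) ^ 4 * covol ψ J := by positivity
    linarith
  have hy0 : y ≠ 0 := by
    intro h0
    have := covol_pos ψ hψs hIfull (L := I)
    rw [h0, Nat.cast_zero, zero_mul] at hcovI
    have : (0 : ℝ) < (d : ℝ) ^ 4 * covol ψ I := by positivity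
    linarith
  have hxy : x * y = d ^ 8 := by
    refine Nat.eq_of_factorization_eq (mul_ne_zero hx0 hy0) (pow_ne_zero 8 hd0) fun q => ?_
    by_cases hq : q.Prime
    swap
    · rw [Nat.factorization_eq_zero_of_not_prime _ hq, Nat.factorization_eq_zero_of_not_prime _ hq]
    haveI : Fact q.Prime := ⟨hq⟩
    rw [Nat.factorization_mul hx0 hy0, Finsupp.add_apply, Nat.factorization_pow, Finsupp.smul_apply, smul_eq_mul]
    -- local principal generator `β` and the central unit `u = d`
    obtain ⟨β, -, hβ⟩ := hI.exists_localAt_eq_units_smul hdiv hO q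
    set u : Bˣ := (isUnit_algebraMap_intCast (B := B) (c := (d : ℤ)) (by exact_mod_cast hd0)).unit with hudef
    have hu : (u : B) = algebraMap ℚ B ((d : ℤ) : ℚ) := rfl
    have hcomm : ∀ w : B, w * (u : B) = (u : B) * w := fun w => by rw [hu]; exact (Algebra.commutes _ _).symm
    have hcomm' : ∀ w : B, ((u⁻¹ : Bˣ) : B) * w = w * ((u⁻¹ : Bˣ) : B) := fun w => by
      rw [Units.inv_mul_eq_iff_eq_mul, ← mul_assoc, ← hcomm w, Units.mul_inv_cancel_right]
    have hΛu : ((d : ℤ) • localAt q O) = u • localAt q O := intCast_smul_eq_units_smul u hu _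
    have hfgI : I.FG := hIfull.1
    -- `(d I)₍q₎ = (β u) O₍q₎`
    set z₁ : Bˣ := β * u with hz₁
    have hdIq : localAt q ((d : ℤ) • I) = z₁ • localAt q O := by
      rw [← intCast_smul_localAt, hβ, ← units_smul_intCast_smul, hΛu, smul_smul]
    -- `(d J)₍q₎ = O₍q₎ (u β⁻¹)`
    set z₂ : Bˣ := u * β⁻¹ with hz₂
    have hdJq : localAt q ((d : ℤ) • J) = MulOpposite.op (z₂ : B) • localAt q O := by
      rw [← intCast_smul_localAt, hJ, ← transporterLeft_localAt q hfgI O, hβ,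
        transporterLeft_units_smul_eq hO.one_mem_localAt (fun a ha b hb => hO.mul_mem_localAt ha hb) β,
        intCast_smul_op_units_smul, hΛu]
      -- `op β⁻¹ • (u • Λ) = op (u β⁻¹) • Λ` (`u` central)
      ext w
      rw [mem_op_units_smul_submodule_iff, mem_units_smul_iff_mul_mem,
        mem_op_units_smul_submodule_iff, hz₂, mul_inv_rev, inv_inv,
        Units.val_mul, hcomm' (w * _), mul_assoc]
    -- both generators lie in `O₍q₎`
    have hz₁Λ : (z₁ : B) ∈ localAt q O := by
      have h1 : (z₁ : B) ∈ z₁ • localAt q O := by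
        rw [mem_units_smul_iff_mul_mem, Units.inv_mul]; exact hO.one_mem_localAt
      rw [← hdIq] at h1
      exact localAt_mono q hdI h1
    have hz₂Λ : (z₂ : B) ∈ localAt q O := by
      have h1 : (z₂ : B) ∈ MulOpposite.op (z₂ : B) • localAt q O := by
        rw [mem_op_units_smul_submodule_iff, Units.mul_inv]; exact hO.one_mem_localAt
      rw [← hdJq] at h1
      exact localAt_mono q hdJ h1
    obtain ⟨k₁, hk₁, hidx₁⟩ := exists_relIndex_units_smul_localAt_eq_pow hO z₁ hz₁Λ
    obtain ⟨k₂, hk₂, -⟩ := exists_relIndex_units_smul_localAt_eq_pow hO z₂ hz₂Λ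
    have hidx₂ := relIndex_op_units_smul_localAt hO z₂ hz₂Λ hk₂
    -- local indices are the `q`-parts of `y`, `x`
    have hyq := relIndex_localAt O ((d : ℤ) • I) hdI (p := q) hy0
    have hxq := relIndex_localAt O ((d : ℤ) • J) hdJ (p := q) hx0
    rw [← hy, hdIq, hidx₁] at hyq
    rw [← hx, hdJq, hidx₂] at hxq
    have e₁ : y.factorization q = 2 * k₁ := (Nat.pow_right_injective hq.two_le hyq).symm
    have e₂ : x.factorization q = 2 * k₂ := (Nat.pow_right_injective hq.two_le hxq).symm
    -- `k₁ + k₂ = 4 v_q(d)` from `nrd z₁ nrd z₂ = d⁴`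
    have hzz : (z₁ : B) * z₂ = (u : B) * u := by
      rw [hz₁, hz₂, Units.val_mul, Units.val_mul, hcomm, mul_assoc, ← mul_assoc (β : B), hcomm (β : B),
        mul_assoc, Units.mul_inv, mul_one]
    have hprod : reducedNorm ℚ B (z₁ : B) * reducedNorm ℚ B (z₂ : B) = ((d : ℚ) ^ 2) ^ 2 := by
      rw [← reducedNorm_mul_holds ℚ B, hzz, reducedNorm_mul_holds ℚ B, hu, reducedNorm_algebraMap]
      push_cast; ring
    haveI : Nontrivial B := Module.nontrivial_of_finrank_pos (R := ℚ)
      (by rw [IsQuaternionAlgebra.finrank_eq_four (K := ℚ) (D := B)]; norm_num)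
    have hval : (k₁ : ℤ) + k₂ = 4 * d.factorization q := by
      have h0₁ : reducedNorm ℚ B (z₁ : B) ≠ 0 := reducedNorm_ne_zero_of_ne_zero hdiv z₁.ne_zero
      have h0₂ : reducedNorm ℚ B (z₂ : B) ≠ 0 := reducedNorm_ne_zero_of_ne_zero hdiv z₂.ne_zero
      have h := congrArg (padicValRat q) hprod
      rw [padicValRat.mul h0₁ h0₂, hk₁, hk₂, padicValRat.pow, padicValRat.pow, padicValRat.of_nat,
        ← Nat.factorization_def d hq] at h
      push_cast at h
      linarith
    have hval' : k₁ + k₂ = 4 * d.factorization q := by exact_mod_cast hval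
    rw [e₁, e₂]
    omega
  -- assemble
  have hd8 : (x : ℝ) * y = (d : ℝ) ^ 8 := by exact_mod_cast hxy
  have key : ((d : ℝ) ^ 4 * covol ψ J) * ((d : ℝ) ^ 4 * covol ψ I) = (d : ℝ) ^ 8 * covol ψ O ^ 2 := by
    rw [hcovI, hcovJ]
    linear_combination (covol ψ O ^ 2) * hd8
  have h2 : (d : ℝ) ^ 8 * (covol ψ J * covol ψ I) = (d : ℝ) ^ 8 * covol ψ O ^ 2 := by
    rw [← key]; ring
  exact mul_left_cancel₀ (by positivity) h2

end Main

end Literature.NumberTheory.Automorphic
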